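import Summits.CriticalPhenomena.Ising3D.Control2DTermwise
import Literature.MathematicalPhysics.QuantumFieldTheory.ConformalBootstrap3D.MeanFieldDecomposition
import Mathlib.Tactic
import HarnessLib

/-!
# The chiral (sl(2)) block expansions of `x^s` and `(x/(1-x))^s`
(cell `pub-ising3x`, seat controls-1 gen 35; NON-VACUITY of the 2D control's typed hypothesis class,
step 1 of 2 — CONTROL-ONLY)

HONEST FRAMING: lottery ticket; floor = tightest certified 3D Ising CFT bounds; no exact-solution
claim without a proof. CONTROL-ONLY (`d = 2`); nothing numerical is asserted here.

Every typed 2D statement of the control (`GapExcluded`, `OpeBound`, `BoxExcluded`, `ExcludedAt`,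
`TwoSided`, … of `Control2DBootstrap` / `Control2DIsland`) quantifies over `CrossingData` satisfying
`IsUnitary ∧ SatisfiesCrossing s`. `Control2DNonVacuity` exhibits a member of that class for every
`s > 0` — the two-dimensional generalised free field — from the two ONE-DIMENSIONAL expansions proved
here: for `s > 0` and `0 < x < 1`, with `k_{2h}(x) = x^h ₂F₁(h,h;2h;x)` (`chiralBlock h x`) and
`b_n(s) = (s)_n² / (n! (2s+n-1)_n)` (`gffChiralCoeff s n`),

* `hasSum_gffChiral_ratio` : `Σ_n b_n(s) k_{2(s+n)}(x) = (x/(1-x))^s`,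
* `hasSum_gffChiral_pow`   : `Σ_n (-1)^n b_n(s) k_{2(s+n)}(x) = x^s`

(the chiral halves of `u^s` and `(u/v)^s`; these are the `d = 1` generalised-free-field block
expansions, the `d = 2h = 2` chiral factors of the double-twist coefficients of Fitzpatrick–Kaplan
2012 §2.2). Method: both sides are generalised power series `x^s Σ_K c_K x^K`; the coefficient
identities `Σ_{n ≤ K} b_n a_{K-n}(s+n) = (s)_K/K!` and `Σ_{n ≤ K} (-1)^n b_n a_{K-n}(s+n) = [K = 0]`
(`a_m(h) = chiralCoeff h m = (h)_m²/(m!(2h)_m)`) follow from a Pascal-type splitting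
(`gffTerm_succ_succ`) and the finite identity `Σ_n C(N,n)/(2s+n)_{N+1} = 1/(2 (s)_{N+1})`
(`gffPascalSum_eq`, induction on `N`); Tonelli on the non-negative double family and Mathlib's binomial
series (`hasSum_poch_div_factorial_mul_pow`) do the rest. Finite algebra + elementary real analysis.

References: A. L. Fitzpatrick, J. Kaplan, JHEP 10 (2012) 032, §2.2 [cite: FitzpatrickKaplan2012, §2.2];
F. A. Dolan, H. Osborn, Nucl. Phys. B 678 (2004) 491, §3 [cite: DolanOsborn2004, §3]. Tree:
`chiralCoeff`, `hasSum_chiralBlock` (`Control2DTermwise`), `poch`, `hasSum_poch_div_factorial_mul_pow`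
(`Literature/…/ConformalBootstrap3D/MeanField{Coefficients,Decomposition}`).
-/

namespace Summit.CriticalPhenomena.Ising3D.Control2D

open Finset Set
open Literature.MathematicalPhysics.QuantumFieldTheory.ConformalBootstrap3D

/-! ### Pochhammer bookkeeping -/

/-- Mathlib's `ascPochhammer` evaluated at a real is the tree's `poch`. [folklore] -/
theorem ascPochhammer_eval_eq_poch (x : ℝ) (n : ℕ) : (ascPochhammer ℝ n).eval x = poch x n := by
  induction n with
  | zero => simp
  | succ n ih => rw [ascPochhammer_succ_eval, poch_succ, ih]

/-- `a_m(h) = (h)_m² / (m! (2h)_m)` in terms of `poch`. [cite: DolanOsborn2004, §3] -/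
theorem chiralCoeff_eq_poch (h : ℝ) (m : ℕ) :
    chiralCoeff h m = poch h m ^ 2 / ((m.factorial : ℝ) * poch (2 * h) m) := by
  unfold chiralCoeff ordinaryHypergeometricCoefficient
  rw [ascPochhammer_eval_eq_poch, ascPochhammer_eval_eq_poch, div_eq_mul_inv, mul_inv]
  ring

/-- Partial fractions for the rising factorial: `1/(y)_{N+2} = (1/(N+1)) (1/(y)_{N+1} - 1/(y+1)_{N+1})`
for `y > 0`. [folklore] -/
theorem inv_poch_succ_succ {y : ℝ} (hy : 0 < y) (N : ℕ) :
    1 / poch y (N + 2) = (1 / poch y (N + 1) - 1 / poch (y + 1) (N + 1)) / ((N : ℝ) + 1) := by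
  have h1 : poch y (N + 2) = poch y (N + 1) * (y + ((N : ℝ) + 1)) := by
    rw [show N + 2 = (N + 1) + 1 by ring, poch_succ]; push_cast; ring
  have h2 : poch y (N + 2) = y * poch (y + 1) (N + 1) := by
    rw [show N + 2 = (N + 1) + 1 by ring, poch_succ_left]
  have hp1 : 0 < poch y (N + 1) := poch_pos hy _
  have hp2 : 0 < poch (y + 1) (N + 1) := poch_pos (by linarith) _
  have hp : 0 < poch y (N + 2) := poch_pos hy _
  have e1 : 1 / poch y (N + 1) = (y + ((N : ℝ) + 1)) / poch y (N + 2) := by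
    rw [h1]; field_simp
  have e2 : 1 / poch (y + 1) (N + 1) = y / poch y (N + 2) := by
    rw [h2]; field_simp
  rw [e1, e2]
  field_simp
  ring

/-! ### The generalised-free-field chiral coefficients -/

/-- `b_n(s) = (s)_n² / (n! (2s+n-1)_n)`: the coefficient of `k_{2(s+n)}` in the chiral expansions of
`(x/(1-x))^s` and (with the sign `(-1)^n`) of `x^s`. The `d = 1` generalised-free-field OPE
coefficients. [cite: FitzpatrickKaplan2012, §2.2] -/
noncomputable def gffChiralCoeff (s : ℝ) (n : ℕ) : ℝ :=
  poch s n ^ 2 / ((n.factorial : ℝ) * poch (2 * s + n - 1) n)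

/-- `b_0 = 1`. [folklore] -/
@[simp] theorem gffChiralCoeff_zero (s : ℝ) : gffChiralCoeff s 0 = 1 := by
  simp [gffChiralCoeff]

/-- The denominator `(2s+n-1)_n` is positive for `s > 0` (empty product at `n = 0`, base `≥ 2s`
otherwise). [folklore] -/
theorem poch_gffBase_pos {s : ℝ} (hs : 0 < s) (n : ℕ) : 0 < poch (2 * s + n - 1) n := by
  rcases n with _ | n
  · simp
  · exact poch_pos (by push_cast; linarith) _

/-- `b_n(s) > 0` for `s > 0`. [folklore] -/
theorem gffChiralCoeff_pos {s : ℝ} (hs : 0 < s) (n : ℕ) : 0 < gffChiralCoeff s n := by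
  unfold gffChiralCoeff
  have := poch_pos hs n
  have := poch_gffBase_pos hs n
  positivity

/-- `b_n(s) ≥ 0` for `s > 0`. [folklore] -/
theorem gffChiralCoeff_nonneg {s : ℝ} (hs : 0 < s) (n : ℕ) : 0 ≤ gffChiralCoeff s n :=
  (gffChiralCoeff_pos hs n).le

/-! ### The finite identities -/

/-- `A_N(n) = C(N,n) / (2s+n)_{N+1}`. [folklore] -/
noncomputable def gffPascal (s : ℝ) (N n : ℕ) : ℝ :=
  (N.choose n : ℝ) / poch (2 * s + n) (N + 1)

/-- `T_K(n) = C(K,n) / ((2s+n-1)_n (2s+2n)_{K-n})`: the normalised convolution term,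
`b_n a_{K-n}(s+n) = ((s)_K²/K!) T_K(n)` (`gffChiralCoeff_mul_chiralCoeff`). [folklore] -/
noncomputable def gffTerm (s : ℝ) (K n : ℕ) : ℝ :=
  (K.choose n : ℝ) / (poch (2 * s + n - 1) n * poch (2 * s + 2 * n) (K - n))

/-- `T_{N+1}(0) = A_N(0)`. [folklore] -/
theorem gffTerm_succ_zero (s : ℝ) (N : ℕ) : gffTerm s (N + 1) 0 = gffPascal s N 0 := by
  simp [gffTerm, gffPascal]

/-- **The Pascal splitting** `T_{N+1}(n+1) = A_N(n+1) + A_N(n)` (`n ≤ N`, `s > 0`): the identity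
`C(N+1,n+1)(2s+2n+1) = C(N,n+1)(2s+n) + C(N,n)(2s+n+N+1)` over the common denominator `(2s+n)_{N+2}`.
[folklore] -/
theorem gffTerm_succ_succ {s : ℝ} (hs : 0 < s) {N n : ℕ} (hn : n ≤ N) :
    gffTerm s (N + 1) (n + 1) = gffPascal s N (n + 1) + gffPascal s N n := by
  unfold gffTerm gffPascal
  set y : ℝ := 2 * s + n with hy_def
  have hy : 0 < y := by rw [hy_def]; positivity
  have hbase : 2 * s + ((n + 1 : ℕ) : ℝ) - 1 = y := by push_cast; rw [hy_def]; ring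
  have hbase2 : 2 * s + 2 * ((n + 1 : ℕ) : ℝ) = y + ((n : ℝ) + 2) := by push_cast; rw [hy_def]; ring
  have hsub : N + 1 - (n + 1) = N - n := by omega
  have hchoose1 : 2 * s + ((n + 1 : ℕ) : ℝ) = y + 1 := by push_cast; rw [hy_def]; ring
  rw [hbase, hbase2, hsub, hchoose1]
  -- the three denominators against `(y)_{N+2}`
  have d1 : poch y (N + 2) = poch y (n + 1) * ((y + ((n : ℝ) + 1)) * poch (y + ((n : ℝ) + 2)) (N - n)) := by
    have e : N + 2 = (n + 1) + ((N - n) + 1) := by omega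
    rw [e, poch_add, poch_succ_left (y + ((n + 1 : ℕ) : ℝ)) (N - n)]
    push_cast
    ring
  have d2 : poch y (N + 2) = y * poch (y + 1) (N + 1) := by
    rw [show N + 2 = (N + 1) + 1 by ring, poch_succ_left]
  have d3 : poch y (N + 2) = poch y (N + 1) * (y + ((N : ℝ) + 1)) := by
    rw [show N + 2 = (N + 1) + 1 by ring, poch_succ]; push_cast; ring
  have hp0 : 0 < poch y (N + 2) := poch_pos hy _
  have hp1 : 0 < poch y (n + 1) := poch_pos hy _
  have hp2 : 0 < poch (y + ((n : ℝ) + 2)) (N - n) := poch_pos (by linarith) _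
  have hp3 : 0 < poch (y + 1) (N + 1) := poch_pos (by linarith) _
  have hp4 : 0 < poch y (N + 1) := poch_pos hy _
  have e1 : ((N + 1).choose (n + 1) : ℝ) / (poch y (n + 1) * poch (y + ((n : ℝ) + 2)) (N - n)) =
      ((N + 1).choose (n + 1) : ℝ) * (y + ((n : ℝ) + 1)) / poch y (N + 2) := by
    rw [d1]; field_simp
  have e2 : (N.choose (n + 1) : ℝ) / poch (y + 1) (N + 1) = (N.choose (n + 1) : ℝ) * y / poch y (N + 2) := by
    rw [d2]; field_simp
  have e3 : (N.choose n : ℝ) / poch y (N + 1) = (N.choose n : ℝ) * (y + ((N : ℝ) + 1)) / poch y (N + 2) := by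
    rw [d3]; field_simp
  rw [e1, e2, e3, ← add_div, div_left_inj' hp0.ne']
  -- the binomial identity
  have hP : ((N + 1).choose (n + 1) : ℝ) = (N.choose n : ℝ) + (N.choose (n + 1) : ℝ) := by
    rw [Nat.choose_succ_succ]; push_cast; ring
  have hQ : (N.choose (n + 1) : ℝ) * ((n : ℝ) + 1) = (N.choose n : ℝ) * ((N : ℝ) - n) := by
    have h := Nat.choose_succ_right_eq N n
    have h' : ((N.choose (n + 1) * (n + 1) : ℕ) : ℝ) = ((N.choose n * (N - n) : ℕ) : ℝ) := by rw [h]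
    push_cast [Nat.cast_sub hn] at h'
    linarith
  rw [hP]
  linear_combination hQ

/-- `A_N(N+1) = 0` (`C(N,N+1) = 0`). [folklore] -/
theorem gffPascal_succ_self (s : ℝ) (N : ℕ) : gffPascal s N (N + 1) = 0 := by
  simp [gffPascal, Nat.choose_succ_self]

/-- **The alternating convolution vanishes**: `Σ_{n ≤ N+1} (-1)^n T_{N+1}(n) = 0` (telescoping on the
Pascal splitting). [folklore] -/
theorem gffTerm_alternating_sum {s : ℝ} (hs : 0 < s) (N : ℕ) :
    ∑ n ∈ range (N + 2), (-1 : ℝ) ^ n * gffTerm s (N + 1) n = 0 := by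
  rw [sum_range_succ', gffTerm_succ_zero]
  have h : ∀ n ∈ range (N + 1), (-1 : ℝ) ^ (n + 1) * gffTerm s (N + 1) (n + 1) =
      (-1 : ℝ) ^ (n + 1) * gffPascal s N (n + 1) - (-1 : ℝ) ^ n * gffPascal s N n := by
    intro n hn
    rw [Finset.mem_range] at hn
    rw [gffTerm_succ_succ hs (by omega), pow_succ]
    ring
  rw [sum_congr rfl h, sum_sub_distrib]
  have h2 : ∑ n ∈ range (N + 1), (-1 : ℝ) ^ (n + 1) * gffPascal s N (n + 1) =
      ∑ n ∈ range (N + 1), (-1 : ℝ) ^ n * gffPascal s N n - (-1 : ℝ) ^ 0 * gffPascal s N 0 := by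
    have := sum_range_succ' (fun n => (-1 : ℝ) ^ n * gffPascal s N n) (N + 1)
    rw [sum_range_succ, gffPascal_succ_self, mul_zero, add_zero] at this
    linarith
  rw [h2]
  simp

/-- **The plain convolution**: `Σ_{n ≤ N+1} T_{N+1}(n) = 2 Σ_{n ≤ N} A_N(n)`. [folklore] -/
theorem gffTerm_sum {s : ℝ} (hs : 0 < s) (N : ℕ) :
    ∑ n ∈ range (N + 2), gffTerm s (N + 1) n = 2 * ∑ n ∈ range (N + 1), gffPascal s N n := by
  rw [sum_range_succ', gffTerm_succ_zero]
  have h : ∀ n ∈ range (N + 1), gffTerm s (N + 1) (n + 1) = gffPascal s N (n + 1) + gffPascal s N n := by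
    intro n hn
    rw [Finset.mem_range] at hn
    exact gffTerm_succ_succ hs (by omega)
  rw [sum_congr rfl h, sum_add_distrib]
  have h2 : ∑ n ∈ range (N + 1), gffPascal s N (n + 1) =
      ∑ n ∈ range (N + 1), gffPascal s N n - gffPascal s N 0 := by
    have := sum_range_succ' (fun n => gffPascal s N n) (N + 1)
    rw [sum_range_succ, gffPascal_succ_self, add_zero] at this
    linarith
  rw [h2]
  ring

/-- **`Σ_{n ≤ N} C(N,n)/(2s+n)_{N+1} = 1/(2 (s)_{N+1})`** for `s > 0` (induction on `N`, using Pascal's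
rule and the partial fractions `inv_poch_succ_succ` at `y = 2s+n` and at `y = s`). [folklore] -/
theorem gffPascalSum_eq (N : ℕ) : ∀ {s : ℝ}, 0 < s →
    ∑ n ∈ range (N + 1), gffPascal s N n = 1 / (2 * poch s (N + 1)) := by
  induction N with
  | zero =>
    intro s hs
    simp [gffPascal]
  | succ N ih =>
    intro s hs
    have hs1 : 0 < s + 1 := by linarith
    -- peel `n = 0`, apply Pascal, re-absorb
    have step1 : ∑ n ∈ range (N + 2), gffPascal s (N + 1) n =
        ∑ n ∈ range (N + 1), ((N.choose n : ℝ) / poch (2 * s + n) (N + 2) +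
          (N.choose n : ℝ) / poch (2 * s + n + 1) (N + 2)) := by
      unfold gffPascal
      rw [sum_range_succ']
      have hP : ∀ n ∈ range (N + 1), (((N + 1).choose (n + 1) : ℕ) : ℝ) / poch (2 * s + ((n + 1 : ℕ) : ℝ)) (N + 1 + 1) =
          (N.choose n : ℝ) / poch (2 * s + n + 1) (N + 2) + (N.choose (n + 1) : ℝ) / poch (2 * s + ((n + 1 : ℕ) : ℝ)) (N + 2) := by
        intro n _
        rw [Nat.choose_succ_succ]
        push_cast
        rw [show 2 * s + ((n : ℝ) + 1) = 2 * s + n + 1 by ring]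
        ring
      rw [sum_congr rfl hP, sum_add_distrib]
      have hre : ∑ n ∈ range (N + 1), (N.choose (n + 1) : ℝ) / poch (2 * s + ((n + 1 : ℕ) : ℝ)) (N + 2) +
          (((N + 1).choose 0 : ℕ) : ℝ) / poch (2 * s + ((0 : ℕ) : ℝ)) (N + 1 + 1) =
          ∑ n ∈ range (N + 1), (N.choose n : ℝ) / poch (2 * s + n) (N + 2) := by
        have := sum_range_succ' (fun n => (N.choose n : ℝ) / poch (2 * s + n) (N + 2)) (N + 1)
        rw [sum_range_succ, Nat.choose_succ_self] at this
        simp only [Nat.cast_zero, zero_div, add_zero] at this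
        rw [this]
        simp
      rw [add_assoc, hre, ← sum_add_distrib]
      refine sum_congr rfl fun n _ => ?_
      ring
    rw [step1]
    -- partial fractions termwise
    have step2 : ∀ n ∈ range (N + 1), (N.choose n : ℝ) / poch (2 * s + n) (N + 2) +
        (N.choose n : ℝ) / poch (2 * s + n + 1) (N + 2) =
        ((N.choose n : ℝ) / poch (2 * s + n) (N + 1) - (N.choose n : ℝ) / poch (2 * (s + 1) + n) (N + 1)) /
          ((N : ℝ) + 1) := by
      intro n _
      have hy : 0 < 2 * s + n := by positivity
      have hy1 : 0 < 2 * s + n + 1 := by positivity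
      have A := inv_poch_succ_succ hy N
      have B := inv_poch_succ_succ hy1 N
      rw [show 2 * (s + 1) + (n : ℝ) = 2 * s + n + 1 + 1 by ring]
      rw [div_eq_mul_one_div (N.choose n : ℝ) (poch (2 * s + n) (N + 2)), A,
        div_eq_mul_one_div (N.choose n : ℝ) (poch (2 * s + n + 1) (N + 2)), B]
      field_simp
      ring
    rw [sum_congr rfl step2, ← sum_div, sum_sub_distrib]
    have e1 := ih hs
    have e2 := ih hs1
    unfold gffPascal at e1 e2
    rw [e1, e2]
    have C := inv_poch_succ_succ hs N
    rw [show N + 1 + 1 = N + 2 by ring]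
    have hp0 : 0 < poch s (N + 2) := poch_pos hs _
    have hp1 : 0 < poch s (N + 1) := poch_pos hs _
    have hp2 : 0 < poch (s + 1) (N + 1) := poch_pos hs1 _
    have C' : 1 / poch s (N + 1) - 1 / poch (s + 1) (N + 1) = ((N : ℝ) + 1) / poch s (N + 2) := by
      have hN : ((N : ℝ) + 1) ≠ 0 := by positivity
      rw [eq_div_iff hN] at C
      rw [← C]
      field_simp
    have : 1 / (2 * poch s (N + 1)) - 1 / (2 * poch (s + 1) (N + 1)) =
        (1 / poch s (N + 1) - 1 / poch (s + 1) (N + 1)) / 2 := by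
      field_simp
    rw [this, C']
    field_simp

/-- `Σ_{n ≤ K} T_K(n) = 1/(s)_K` (`K ≥ 1` from the two previous lemmas; `K = 0` directly). [folklore] -/
theorem gffTerm_sum_eq {s : ℝ} (hs : 0 < s) (K : ℕ) :
    ∑ n ∈ range (K + 1), gffTerm s K n = 1 / poch s K := by
  rcases K with _ | N
  · simp [gffTerm]
  · rw [show N + 1 + 1 = N + 2 by ring, gffTerm_sum hs N, gffPascalSum_eq N hs]
    have := poch_pos hs (N + 1)
    field_simp

/-- `Σ_{n ≤ K} (-1)^n T_K(n) = [K = 0]`. [folklore] -/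
theorem gffTerm_alternating_sum_eq {s : ℝ} (hs : 0 < s) (K : ℕ) :
    ∑ n ∈ range (K + 1), (-1 : ℝ) ^ n * gffTerm s K n = if K = 0 then 1 else 0 := by
  rcases K with _ | N
  · simp [gffTerm]
  · rw [show N + 1 + 1 = N + 2 by ring, gffTerm_alternating_sum hs N]
    simp

/-- **The convolution term factorises**: `b_n(s) a_{K-n}(s+n) = ((s)_K² / K!) T_K(n)` for `n ≤ K`
(`(s)_K = (s)_n (s+n)_{K-n}`). [folklore] -/
theorem gffChiralCoeff_mul_chiralCoeff {s : ℝ} (hs : 0 < s) {K n : ℕ} (hn : n ≤ K) :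
    gffChiralCoeff s n * chiralCoeff (s + n) (K - n) =
      poch s K ^ 2 / (K.factorial : ℝ) * gffTerm s K n := by
  rw [gffChiralCoeff, chiralCoeff_eq_poch, gffTerm, Nat.cast_choose ℝ hn]
  have hK : poch s K = poch s n * poch (s + n) (K - n) := by
    rw [← poch_add]; congr 1; omega
  rw [hK, show 2 * (s + (n : ℝ)) = 2 * s + 2 * n by ring]
  have h1 : 0 < poch (2 * s + n - 1) n := poch_gffBase_pos hs n
  have h2 : 0 < poch (2 * s + 2 * n) (K - n) := poch_pos (by positivity) _
  have h3 : (0 : ℝ) < n.factorial := by positivity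
  have h4 : (0 : ℝ) < (K - n).factorial := by positivity
  have h5 : (0 : ℝ) < K.factorial := by positivity
  field_simp

/-- **Coefficient identity I**: `Σ_{n ≤ K} b_n(s) a_{K-n}(s+n) = (s)_K / K!` — the coefficient of
`x^{s+K}` in `(x/(1-x))^s = x^s Σ_K (s)_K/K! x^K`. [folklore] -/
theorem gff_convolution_eq {s : ℝ} (hs : 0 < s) (K : ℕ) :
    ∑ n ∈ range (K + 1), gffChiralCoeff s n * chiralCoeff (s + n) (K - n) =
      poch s K / (K.factorial : ℝ) := by
  have h : ∀ n ∈ range (K + 1), gffChiralCoeff s n * chiralCoeff (s + n) (K - n) =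
      poch s K ^ 2 / (K.factorial : ℝ) * gffTerm s K n := by
    intro n hn
    rw [Finset.mem_range] at hn
    exact gffChiralCoeff_mul_chiralCoeff hs (by omega)
  rw [sum_congr rfl h, ← mul_sum, gffTerm_sum_eq hs]
  have := poch_pos hs K
  field_simp

/-- **Coefficient identity II**: `Σ_{n ≤ K} (-1)^n b_n(s) a_{K-n}(s+n) = [K = 0]` — the coefficient of
`x^{s+K}` in `x^s`. [folklore] -/
theorem gff_alternating_convolution_eq {s : ℝ} (hs : 0 < s) (K : ℕ) :
    ∑ n ∈ range (K + 1), (-1 : ℝ) ^ n * (gffChiralCoeff s n * chiralCoeff (s + n) (K - n)) =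
      if K = 0 then 1 else 0 := by
  have h : ∀ n ∈ range (K + 1), (-1 : ℝ) ^ n * (gffChiralCoeff s n * chiralCoeff (s + n) (K - n)) =
      poch s K ^ 2 / (K.factorial : ℝ) * ((-1 : ℝ) ^ n * gffTerm s K n) := by
    intro n hn
    rw [Finset.mem_range] at hn
    rw [gffChiralCoeff_mul_chiralCoeff hs (by omega)]
    ring
  rw [sum_congr rfl h, ← mul_sum, gffTerm_alternating_sum_eq hs]
  split_ifs with hK
  · subst hK; simp
  · simp

end Summit.CriticalPhenomena.Ising3D.Control2D
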